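import Summits.BirchSwinnertonDyer.BirchSwinnertonDyer.Theorems.UniversalToricDescentAdditiveSplitIMCInclusionAtThreeStubDescent
import HarnessLib

/-!
# Stub `stub_ratDescent` (v2) of line `ratwall_thin_comb` on the UTD parent crux `ToricTransportModThree`
# (stmt-BirchSwinnertonDyer-20186) — CLOSED (LEAD bsd-wall-utd-p1 g19, 2026-08-29)

The RATIONAL two-variable descent: in a v2 frame `(κ₁, κ₂; γ₁, γ₂; k)` of the `ℤ₃²`-tower, with `X₂ = XGr₂ (E/K) 3 κ₁ κ₂ 𝔭′ γ₁ γ₂`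
finitely generated and torsion over `Λ₂`, every pseudo-null submodule finite (S3n′), `ch X₂ = (g)`, `G = g` read in `Λ₂(R₀)`:
`G ∣ 3^a·L₂` and `3^t·L₂ ≡ u·3^s·L(T₁) (mod 𝔞_k)` give `3^{a+s}·L ∈ Ch_Λ(X_ac(E/K_∞))·R₀⟦T⟧`.

Proof: a COROLLARY of the landed integral descent `…ThinCombLine.stub_descent` (cruxlead-20395 g3, thin_comb v3) applied to
`L₂′ := 3^t·(3^a·L₂)` and `L′ := 3^{a+s}·L`: `G ∣ L₂′`, and `L₂′ − u·C(L′) = 3^a·(3^t·L₂ − u·3^s·C(L)) ∈ 𝔞_k`; its output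
`(L′) ⊆ Ch·R₀⟦T⟧` is the claim with `k′ = a + s`.

Registered signature VERBATIM (skeleton v2 sha16 2f6f153a9e914ebb: the pen's v1 text + the S3n′ hypothesis, see the skeleton header),
in the skeleton's namespace. References: [SkinnerUrban2014] §3.2.7–3.2.9; [Greenberg2016] Prop. 4.1.1; [Delbourgo2008] Lemma 10.5.
-/

set_option linter.dupNamespace false
set_option autoImplicit false

noncomputable section

open NumberField IsDedekindDomain Field
open Literature.NumberTheory.EllipticCurves
open Summit.BirchSwinnertonDyer.BirchSwinnertonDyer.Theorems.UniversalToricDescentThinComb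

namespace Summit.BirchSwinnertonDyer.BirchSwinnertonDyer.Cruxes.ToricTransportModThree.RatwallThinComb

/-- `const` and `map C` read the natural number `3` as the element `3` of `Λ₂(𝒪)`: the 3-power bookkeeping identity
`3^t·(3^a·L₂) − u·C(3^{a+s}·L) = 3^a·(3^t·L₂ − u·3^s·C(L))`. [folklore] -/
theorem pow_bookkeeping (L₂ : PowerSeries (PowerSeries (unrIntegers 3))) (L : UnrSeries 3)
    (u : PowerSeries (PowerSeries (unrIntegers 3))) (a t s : ℕ) :
    const (unrIntegers 3) (((3 : ℕ) : unrIntegers 3) ^ t) * (const (unrIntegers 3) (((3 : ℕ) : unrIntegers 3) ^ a) * L₂) -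
        u * PowerSeries.map (PowerSeries.C (R := unrIntegers 3)) (((3 : ℕ) : UnrSeries 3) ^ (a + s) * L) =
      const (unrIntegers 3) (((3 : ℕ) : unrIntegers 3) ^ a) *
        (const (unrIntegers 3) (((3 : ℕ) : unrIntegers 3) ^ t) * L₂ -
          u * const (unrIntegers 3) (((3 : ℕ) : unrIntegers 3) ^ s) *
            PowerSeries.map (PowerSeries.C (R := unrIntegers 3)) L) := by
  simp only [map_pow, map_natCast, map_mul]
  ring

/-- **`stub_ratDescent`** (v2; registered stub of line `ratwall_thin_comb` on stmt-BirchSwinnertonDyer-20186, VERBATIM): the rational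
two-variable descent, from the landed integral `stub_descent` with `L₂ ↦ 3^{a+t}·L₂`, `L ↦ 3^{a+s}·L`.
[cite: SkinnerUrban2014, §3.2.7–3.2.9 (pp. 23–24)] [cite: Greenberg2016, Prop. 4.1.1] -/
theorem stub_ratDescent :
    ∀ (W : WeierstrassCurve ℚ) [W.IsElliptic] [W.IsGloballyMinimal] (K : Type) [Field K] [NumberField K],
    Summit.BirchSwinnertonDyer.Rank1Residual.Additive.ClassO6 W 3 → W.HasSurjectiveModNGaloisRep 3 →
    IsImaginaryQuadratic K →
    ∀ (κ : ZpExtension K 3), κ.IsAnticyclotomic → ∀ (γ : Field.absoluteGaloisGroup K) [Fact (κ.IsTopGenerator γ)]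
      (𝔭 : HeightOneSpectrum (𝓞 K)), ((3 : ℕ) : 𝓞 K) ∈ 𝔭.asIdeal →
    ∀ (𝔭' : HeightOneSpectrum (𝓞 K)), ((3 : ℕ) : 𝓞 K) ∈ 𝔭'.asIdeal → 𝔭' ≠ 𝔭 →
    ∀ (κ₁ κ₂ : ZpExtension K 3) (γ₁ γ₂ : Field.absoluteGaloisGroup K) (k : ℕ)
      [Fact (ZpExtension.IsTopGeneratorPair κ₁ κ₂ γ₁ γ₂)],
    (∀ v : HeightOneSpectrum (𝓞 K), v ≠ 𝔭 → ∀ 𝔓 ∈ v.primesAbove,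
        𝔓.inertia (Field.absoluteGaloisGroup K) ≤ κ₁.kerSubgroup) →
    ZpExtension.pairKer κ₁ κ₂ ≤ κ.kerSubgroup → γ₁ * γ⁻¹ ∈ κ.kerSubgroup → γ₂ * (γ ^ (3 ^ k))⁻¹ ∈ κ.kerSubgroup →
    Module.Finite (IwasawaAlgebra₂ 3) ((W.baseChange K).XGr₂ 3 κ₁ κ₂ 𝔭' γ₁ γ₂) →
    Module.IsTorsion (IwasawaAlgebra₂ 3) ((W.baseChange K).XGr₂ 3 κ₁ κ₂ 𝔭' γ₁ γ₂) →
    (∀ N : Submodule (IwasawaAlgebra₂ 3) ((W.baseChange K).XGr₂ 3 κ₁ κ₂ 𝔭' γ₁ γ₂),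
      Literature.NumberTheory.EllipticCurves.Module.IsPseudoNull (IwasawaAlgebra₂ 3) N → Finite N) →
    ∀ (g : IwasawaAlgebra₂ 3),
      Literature.NumberTheory.EllipticCurves.Module.charIdeal (IwasawaAlgebra₂ 3)
        ((W.baseChange K).XGr₂ 3 κ₁ κ₂ 𝔭' γ₁ γ₂) = Ideal.span {g} →
    ∀ (L₂ : PowerSeries (PowerSeries (unrIntegers 3))) (L : UnrSeries 3) (a : ℕ),
      PowerSeries.map (PowerSeries.map (Summit.BirchSwinnertonDyer.Rank1Residual.X11b.Halves.toUnr 3)) g ∣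
        const (unrIntegers 3) (((3 : ℕ) : unrIntegers 3) ^ a) * L₂ →
      (∃ (u : (PowerSeries (PowerSeries (unrIntegers 3)))ˣ) (t s : ℕ),
        const (unrIntegers 3) (((3 : ℕ) : unrIntegers 3) ^ t) * L₂ -
          u * const (unrIntegers 3) (((3 : ℕ) : unrIntegers 3) ^ s) *
            PowerSeries.map (PowerSeries.C (R := unrIntegers 3)) L ∈
          Ideal.span {T₂ (unrIntegers 3) - ((1 + T₁ (unrIntegers 3)) ^ (3 ^ k) - 1)}) →
      ∃ k' : ℕ, ((3 : ℕ) : UnrSeries 3) ^ k' * L ∈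
        (Summit.BirchSwinnertonDyer.Rank1Residual.X11b.AcSelmer.XAc.charIdeal (W.baseChange K) 3 κ 𝔭' ∅ γ).map
          (PowerSeries.map (Summit.BirchSwinnertonDyer.Rank1Residual.X11b.Halves.toUnr 3)) := by
  intro W _ _ K _ _ hO6 hsurj hK κ hκ γ _ 𝔭 h3 𝔭' h3' hne κ₁ κ₂ γ₁ γ₂ k _ hur₁ hker hγ₁ hγ₂ hfin htors hPN g hg L₂ L a
    hdvd hcmp
  obtain ⟨u, t, s, hu⟩ := hcmp
  have key :=
    Summit.BirchSwinnertonDyer.BirchSwinnertonDyer.Theorems.UniversalToricDescentThinCombLine.stub_descent W K hO6 hsurj hK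
      κ hκ γ 𝔭 h3 𝔭' h3' hne κ₁ κ₂ γ₁ γ₂ k hur₁ hker hγ₁ hγ₂ hfin htors hPN g hg
      (const (unrIntegers 3) (((3 : ℕ) : unrIntegers 3) ^ t) *
        (const (unrIntegers 3) (((3 : ℕ) : unrIntegers 3) ^ a) * L₂))
      (((3 : ℕ) : UnrSeries 3) ^ (a + s) * L) (Dvd.dvd.mul_left hdvd _)
      ⟨u, by rw [pow_bookkeeping]; exact Ideal.mul_mem_left _ _ hu⟩
  exact ⟨a + s, (Ideal.span_singleton_le_iff_mem _).mp key⟩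

end Summit.BirchSwinnertonDyer.BirchSwinnertonDyer.Cruxes.ToricTransportModThree.RatwallThinComb

end
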